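import Literature.NumberTheory.LFunctions.JensenAsymptotics
import HarnessLib

/-!
# The GORZ-type expansion (eq. (15)) for `a_n = γ(n)/n!`

Trunk T-ANT (`Literature/NumberTheory/LFunctions`). Leaf E2 of the decomposition of the named fact
`Literature.NumberTheory.LFunctions.katkova_apf` (Katkova 2006, Thm. 2, `XiMultiplePositivity.lean`). Katkova's sequence is
`a_n = γ(n)/n! = 8 b_n`, `ξ₁(z) = ξ(1/2 + √z) = ∑ b_k z^k` [Katkova2006, §1 eq. (6)], where
`γ = Literature.xiTaylorCoeff` are the GORZ coefficients. `JensenAsymptotics.lean` proves GORZ's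
expansion [GORZPNAS2019, §5.1 eq. (15)] for `γ` (`Literature.NumberTheory.LFunctions.GORZAsymp.logRatio_sub_isLittleO`,
`Literature.NumberTheory.LFunctions.xiTaylorCoeff_logRatio_holds`):
`log(γ(n+j)/γ(n)) = A₀(n) j - (y(n)/2) j² + Q_n(j) + o(δ₀^d)` with `Q` negligible. Here we
subtract the factorial part

`log((n+j)!/n!) = ∑_{k<j} log(n+1+k) = j log(n+1) + (y₁/2)(j² - j) + W¹_n(j) + o(δ₀^d)`,
`y₁(n) = 1/(n+1)`, `W¹` negligible (Steps C′: `log_factorial_ratio`, `sum_log_eq1`,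
`sum_taylor_eq1`, `isLittleO_log_one_add_mul_y1`, `isLittleO_sum_log_sub1` — verbatim analogues
of Step C of `JensenAsymptotics.lean` with `y₁` in place of `y`), and re-run Step E:
`A' = A₀ - log(n+1) + y₁/2 + c'₁`, `δ'² = (y + y₁)/2 - c'₂ ∼ 1/n`, `g'ᵢ = c'ᵢ`
(`xiTaylorCoeff_div_factorial_logRatio_of_two_le`, `xiTaylorCoeff_div_factorial_logRatio`):

> for every `d ≥ 1` there are `A(n)`, `δ(n) → 0⁺`, `gᵢ(n) = o(δ(n)ⁱ)` (`3 ≤ i ≤ d`) with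
> `log(a_{n+j}/a_n) = A(n) j - δ(n)² j² + ∑_{i=3}^{d} gᵢ(n) jⁱ + o(δ(n)^d)`, `0 ≤ j ≤ d`.

This is the hypothesis of `Literature.Analysis.TotalPositivity.ToeplitzAsymp.det_toeplitz_eventually_pos`
(`Literature/Analysis/TotalPositivity/ToeplitzMinorAsymptotics.lean`), giving Katkova's
consecutive-minor statement (`XiMultiplePositivityProofs.lean`).

## References

* M. Griffin, K. Ono, L. Rolen, D. Zagier, *Jensen polynomials for the Riemann zeta function and
  other sequences*, PNAS 116 (2019) 11103–11110, §5.1 eq. (15). [GORZPNAS2019]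
* O. M. Katkova, *Multiple positivity and the Riemann zeta-function*, Comput. Methods Funct.
  Theory 7 (2007) 13–31; arXiv:math/0505174, §1 eq. (6), §2 Prop. 1. [Katkova2006]
-/

noncomputable section

open Real Filter Topology Asymptotics Polynomial Finset
open scoped Nat

namespace Literature.NumberTheory.LFunctions

namespace GORZAsymp

/-! ### The factorial part, with `y₁(n) = 1/(n+1)` -/

/-- `y₁(n) = 1/(n + 1)`. [folklore] -/
def y1 (n : ℕ) : ℝ := 1 / ((n : ℝ) + 1)

/-- `y₁(n) > 0`. [folklore] -/
theorem y1_pos (n : ℕ) : 0 < y1 n := by unfold y1; positivity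

/-- `y₁(n) ≤ 2 δ₀(n)² = 1/n` for `n ≥ 1`. [folklore] -/
theorem y1_le {n : ℕ} (hn : 1 ≤ n) : y1 n ≤ 2 * δ₀ n ^ 2 := by
  rw [δ₀_sq hn, y1]
  have : (1:ℝ) ≤ n := by exact_mod_cast hn
  rw [div_le_iff₀ (by positivity), mul_comm]
  field_simp
  linarith

/-- `y₁(n) → 0`. [folklore] -/
theorem tendsto_y1 : Tendsto y1 atTop (𝓝 0) := by
  have h : ∀ᶠ n in atTop, |y1 n| ≤ 2 * δ₀ n ^ 2 := by
    filter_upwards [eventually_ge_atTop 1] with n hn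
    rw [abs_of_pos (y1_pos n)]; exact y1_le hn
  have h2 : Tendsto (fun n ↦ 2 * δ₀ n ^ 2) atTop (𝓝 0) := by
    simpa using (tendsto_δ₀.pow 2).const_mul 2
  exact squeeze_zero_norm' h h2

/-- `y₁(n)^m = O(δ₀(n)^{2m})`. [folklore] -/
theorem isBigO_y1_pow (m : ℕ) : (fun n ↦ y1 n ^ m) =O[atTop] fun n ↦ δ₀ n ^ (2 * m) := by
  have h1 : y1 =O[atTop] fun n ↦ δ₀ n ^ 2 := by
    refine IsBigO.of_bound 2 ?_
    filter_upwards [eventually_ge_atTop 1] with n hn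
    rw [Real.norm_eq_abs, Real.norm_eq_abs, abs_of_pos (y1_pos n),
      abs_of_nonneg (pow_nonneg (δ₀_nonneg n) 2)]
    exact y1_le hn
  simpa [← pow_mul] using h1.pow m

/-- `W¹_n = ∑_{1 ≤ i < R} (-1)^i y₁^{i+1}/(i+1) F_{i+1}` (the factorial analogue of `Wpoly`).
[folklore] -/
def Wpoly1 (R n : ℕ) : ℝ[X] :=
  ∑ i ∈ Ico 1 R, ((-1 : ℝ) ^ i * y1 n ^ (i + 1) / (i + 1)) • faulhaber (i + 1)

/-- `W¹` is a negligible family. [folklore] -/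
theorem isNegl_Wpoly1 (R : ℕ) : IsNegl (Wpoly1 R) := by
  refine IsNegl.sum _ fun i hi ↦ ?_
  have hi1 : 1 ≤ i := (mem_Ico.1 hi).1
  refine IsNegl.smul_of_isBigO (m := 2 * (i + 1)) ?_ ?_ (faulhaber_coeff_zero _)
  · have h := (isBigO_y1_pow (i + 1)).const_mul_left ((-1 : ℝ) ^ i / (i + 1))
    refine (IsBigO.of_bound' (Eventually.of_forall fun n ↦ le_of_eq ?_)).trans h
    simp only [Real.norm_eq_abs]; congr 1; ring
  · exact lt_of_le_of_lt (natDegree_faulhaber_le _) (by omega)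

/-- `log((n+j)!/n!) = ∑_{k<j} log(n + 1 + k)`. [folklore] -/
theorem log_factorial_ratio (n j : ℕ) :
    Real.log (((n + j)! : ℝ) / n !) = ∑ k ∈ range j, Real.log ((n : ℝ) + 1 + k) := by
  induction j with
  | zero => simp
  | succ j ih =>
    rw [sum_range_succ, ← ih, ← Real.log_mul (by positivity) (by positivity)]
    congr 1
    rw [← add_assoc, Nat.factorial_succ]
    push_cast
    field_simp
    ring

/-- `∑_{k<j} log(n + 1 + k) = j log(n + 1) + ∑_{k<j} log(1 + k y₁(n))`. [folklore] -/
theorem sum_log_eq1 (n j : ℕ) :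
    ∑ k ∈ range j, Real.log ((n : ℝ) + 1 + k) =
      j * Real.log ((n : ℝ) + 1) + ∑ k ∈ range j, Real.log (1 + k * y1 n) := by
  have hv : (0 : ℝ) < n + 1 := by positivity
  have : ∀ k ∈ range j, Real.log ((n : ℝ) + 1 + k) =
      Real.log ((n : ℝ) + 1) + Real.log (1 + k * y1 n) := by
    intro k _
    rw [← Real.log_mul hv.ne' (by have := y1_pos n; positivity)]
    congr 1
    rw [y1]; field_simp
  rw [sum_congr rfl this, sum_add_distrib, sum_const, card_range, nsmul_eq_mul]

/-- Summing the Taylor polynomials of `log(1 + k y₁)` over `k < j`. [folklore] -/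
theorem sum_taylor_eq1 (R n j : ℕ) (hR : 1 ≤ R) :
    ∑ k ∈ range j, ∑ i ∈ range R, (-1 : ℝ) ^ i * ((k : ℝ) * y1 n) ^ (i + 1) / (i + 1) =
      y1 n / 2 * ((j : ℝ) ^ 2 - j) + (Wpoly1 R n).eval (j : ℝ) := by
  rw [sum_comm]
  rw [Finset.range_eq_Ico, ← Finset.sum_Ico_consecutive _ (Nat.zero_le 1) hR,
    show Ico 0 1 = {0} by decide, sum_singleton]
  congr 1
  · simp only [pow_zero, one_mul, zero_add, pow_one, Nat.cast_zero, div_one]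
    rw [← two_mul_sum_range_cast]
    simp only [mul_sum]
    refine sum_congr rfl fun k _ ↦ ?_; ring
  · rw [Wpoly1, eval_finsetSum]
    refine sum_congr rfl fun i _ ↦ ?_
    rw [eval_smul, smul_eq_mul, faulhaber_eval]
    simp only [mul_sum]
    refine sum_congr rfl fun k _ ↦ ?_
    rw [mul_pow]; ring

/-- `log(1 + k y₁(n))` minus its Taylor polynomial of order `R` is `o(δ₀^{2R+1})`. [folklore] -/
theorem isLittleO_log_one_add_mul_y1 (k R : ℕ) :
    (fun n ↦ Real.log (1 + k * y1 n) -
        ∑ i ∈ range R, (-1 : ℝ) ^ i * ((k : ℝ) * y1 n) ^ (i + 1) / (i + 1)) =o[atTop]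
      fun n ↦ δ₀ n ^ (2 * R + 1) := by
  have hsmall : ∀ᶠ n in atTop, (k : ℝ) * y1 n ≤ 1 / 2 := by
    have := (tendsto_y1.const_mul (k : ℝ)); rw [mul_zero] at this
    exact (this.eventually (ge_mem_nhds (by norm_num : (0:ℝ) < 1 / 2))).mono fun n hn ↦ hn
  have hbig : (fun n ↦ Real.log (1 + k * y1 n) -
      ∑ i ∈ range R, (-1 : ℝ) ^ i * ((k : ℝ) * y1 n) ^ (i + 1) / (i + 1)) =O[atTop]
      fun n ↦ y1 n ^ (R + 1) := by
    refine IsBigO.of_bound (2 * (k : ℝ) ^ (R + 1)) ?_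
    filter_upwards [hsmall] with n hn
    set x : ℝ := -(k * y1 n) with hx
    have hkx : 0 ≤ (k : ℝ) * y1 n := by have := y1_pos n; positivity
    have habs : |x| = k * y1 n := by rw [hx, abs_neg, abs_of_nonneg hkx]
    have hx1 : |x| < 1 := by rw [habs]; linarith
    have key := Real.abs_log_sub_add_sum_range_le hx1 R
    have hsum : ∑ i ∈ range R, (-1 : ℝ) ^ i * ((k : ℝ) * y1 n) ^ (i + 1) / (i + 1) =
        -∑ i ∈ range R, x ^ (i + 1) / (i + 1) := by
      rw [← sum_neg_distrib]; refine sum_congr rfl fun i _ ↦ ?_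
      rw [hx, neg_pow ((k : ℝ) * y1 n) (i + 1), pow_succ (-1 : ℝ) i]; ring
    rw [Real.norm_eq_abs, Real.norm_eq_abs, hsum, sub_neg_eq_add,
      show (1 : ℝ) + k * y1 n = 1 - x by rw [hx]; ring, add_comm,
      abs_of_pos (pow_pos (y1_pos n) _)]
    refine key.trans ?_
    rw [div_le_iff₀ (by linarith), habs, mul_pow]
    have h1 : 0 ≤ y1 n ^ (R + 1) := pow_nonneg (y1_pos n).le _
    have h2 : 0 ≤ (k : ℝ) ^ (R + 1) := pow_nonneg (Nat.cast_nonneg k) _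
    nlinarith [mul_nonneg h2 h1]
  refine hbig.trans_isLittleO ((isBigO_y1_pow (R + 1)).trans_isLittleO ?_)
  exact isLittleO_δ₀_pow_of_lt (by omega)

/-- The total Taylor error of the factorial part, `o(δ₀^d)`. [folklore] -/
theorem isLittleO_sum_log_sub1 {d : ℕ} (hd : 1 ≤ d) (j : ℕ) :
    (fun n ↦ ∑ k ∈ range j, Real.log (1 + k * y1 n) -
        (y1 n / 2 * ((j : ℝ) ^ 2 - j) + (Wpoly1 d n).eval (j : ℝ))) =o[atTop]
      fun n ↦ δ₀ n ^ d := by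
  have hs : ∀ n, y1 n / 2 * ((j : ℝ) ^ 2 - j) + (Wpoly1 d n).eval (j : ℝ) =
      ∑ k ∈ range j, ∑ i ∈ range d, (-1 : ℝ) ^ i * ((k : ℝ) * y1 n) ^ (i + 1) / (i + 1) :=
    fun n ↦ (sum_taylor_eq1 d n j hd).symm
  simp only [hs, ← sum_sub_distrib]
  refine IsLittleO.sum fun k _ ↦ ?_
  exact (isLittleO_log_one_add_mul_y1 k d).trans_isBigO (isBigO_δ₀_pow_of_le (by omega))

/-! ### The expansion for `a_n = γ(n)/n!` -/

/-- `Q'_n = Q_n - W¹_n`, the negligible part of the expansion of `log(a(n+j)/a(n))`,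
`a_n = γ(n)/n!`. [folklore] -/
def QpolyF (d n : ℕ) : ℝ[X] := Qpoly d n - Wpoly1 d n

/-- `Q'` is a negligible family. [folklore] -/
theorem isNegl_QpolyF (d : ℕ) : IsNegl (QpolyF d) :=
  (isNegl_Qpoly d).sub (isNegl_Wpoly1 d)

/-- The main linear coefficient for `a_n = γ(n)/n!`: `A₀'(n) = A₀(n) - log(n+1) + y₁(n)/2`.
[folklore] -/
def AseqF0 (n : ℕ) : ℝ := Aseq0 n - Real.log ((n : ℝ) + 1) + y1 n / 2

/-- `log(a(n+j)/a(n)) = A₀'(n) j - ((y(n) + y₁(n))/2) j² + Q'_n(j) + o(δ₀^d)` for `j ≤ d`,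
`a_n = γ(n)/n!`. [folklore] -/
theorem logRatioF_sub_isLittleO {d : ℕ} (hd : 1 ≤ d) {j : ℕ} (hj : j ≤ d) :
    (fun n ↦ Real.log ((xiTaylorCoeff (n + j) / ((n + j)! : ℝ)) / (xiTaylorCoeff n / (n ! : ℝ))) -
        (AseqF0 n * j - (yseq n + y1 n) / 2 * (j : ℝ) ^ 2 + (QpolyF d n).eval (j : ℝ))) =o[atTop]
      fun n ↦ δ₀ n ^ d := by
  have h1 := logRatio_sub_isLittleO hd hj
  have h2 := isLittleO_sum_log_sub1 hd j
  have hident : ∀ n,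
      Real.log ((xiTaylorCoeff (n + j) / ((n + j)! : ℝ)) / (xiTaylorCoeff n / (n ! : ℝ))) -
        (AseqF0 n * j - (yseq n + y1 n) / 2 * (j : ℝ) ^ 2 + (QpolyF d n).eval (j : ℝ)) =
      (Real.log (xiTaylorCoeff (n + j) / xiTaylorCoeff n) -
        (Aseq0 n * j - yseq n / 2 * (j : ℝ) ^ 2 + (Qpoly d n).eval (j : ℝ))) -
      (∑ k ∈ range j, Real.log (1 + k * y1 n) -
        (y1 n / 2 * ((j : ℝ) ^ 2 - j) + (Wpoly1 d n).eval (j : ℝ))) := by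
    intro n
    have hγ1 := xiTaylorCoeff_pos_holds (n + j)
    have hγ2 := xiTaylorCoeff_pos_holds n
    have hf1 : (0 : ℝ) < (n + j)! := by positivity
    have hf2 : (0 : ℝ) < n ! := by positivity
    have e1 : (xiTaylorCoeff (n + j) / ((n + j)! : ℝ)) / (xiTaylorCoeff n / (n ! : ℝ)) =
        (xiTaylorCoeff (n + j) / xiTaylorCoeff n) / (((n + j)! : ℝ) / n !) := by
      field_simp
    rw [e1, Real.log_div (by positivity) (by positivity), log_factorial_ratio, sum_log_eq1,
      QpolyF, eval_sub, AseqF0]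
    ring
  simp only [hident]
  exact h1.sub h2

/-- The coefficients `c'_i(n)` of `Q'_n`. [folklore] -/
def cQF (d i n : ℕ) : ℝ := (QpolyF d n).coeff i

/-- `c'_i(n) = o(δ₀(n)^i)`. [folklore] -/
theorem isLittleO_cQF (d i : ℕ) : (fun n ↦ cQF d i n) =o[atTop] fun n ↦ δ₀ n ^ i :=
  (isNegl_QpolyF d).2.1 i

/-- `A'(n) = A₀'(n) + c'₁(n)`. [folklore] -/
def AseqF (d n : ℕ) : ℝ := AseqF0 n + cQF d 1 n

/-- `δ'(n) = √((y(n) + y₁(n))/2 - c'₂(n))` (so `δ'(n)² ∼ 1/n`). [folklore] -/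
def δseqF (d n : ℕ) : ℝ := Real.sqrt ((yseq n + y1 n) / 2 - cQF d 2 n)

/-- `g'_i(n) = c'_i(n)` for `i ≥ 3`. [folklore] -/
def gseqF (d : ℕ) (i n : ℕ) : ℝ := cQF d i n

/-- Eventually `(y + y₁)/2 - c'₂ ≥ δ₀²/4 > 0`. [folklore] -/
theorem eventually_radicandF (d : ℕ) :
    ∀ᶠ n in atTop, δ₀ n ^ 2 / 4 ≤ (yseq n + y1 n) / 2 - cQF d 2 n := by
  have h := (isLittleO_cQF d 2).def (c := 1 / 4) (by norm_num)
  filter_upwards [h, eventually_ge_atTop 1] with n hn hn1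
  rw [Real.norm_eq_abs, Real.norm_eq_abs, abs_of_nonneg (pow_nonneg (δ₀_nonneg n) 2)] at hn
  have h1 := half_δ₀_sq_le hn1
  have h2 := (abs_le.1 hn).2
  have h3 := (y1_pos n).le
  linarith

/-- Eventually `δ'(n)² = (y + y₁)/2 - c'₂`. [folklore] -/
theorem eventually_δseqF_sq (d : ℕ) :
    ∀ᶠ n in atTop, δseqF d n ^ 2 = (yseq n + y1 n) / 2 - cQF d 2 n := by
  filter_upwards [eventually_radicandF d] with n hn
  exact Real.sq_sqrt (le_trans (by positivity) hn)

/-- Eventually `δ₀(n) ≤ 2 δ'(n)`. [folklore] -/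
theorem eventually_δ₀_le_two_mul_δseqF (d : ℕ) : ∀ᶠ n in atTop, δ₀ n ≤ 2 * δseqF d n := by
  filter_upwards [eventually_radicandF d] with n hn
  have h : (δ₀ n / 2) ^ 2 ≤ (yseq n + y1 n) / 2 - cQF d 2 n := by
    rw [div_pow]; norm_num; linarith
  calc δ₀ n = 2 * Real.sqrt ((δ₀ n / 2) ^ 2) := by
        rw [Real.sqrt_sq (by have := δ₀_nonneg n; positivity)]; ring
    _ ≤ 2 * δseqF d n := by
        unfold δseqF
        exact mul_le_mul_of_nonneg_left (Real.sqrt_le_sqrt h) (by norm_num)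

/-- Eventually `δ'(n) > 0`. [folklore] -/
theorem eventually_δseqF_pos (d : ℕ) : ∀ᶠ n in atTop, 0 < δseqF d n := by
  filter_upwards [eventually_δ₀_le_two_mul_δseqF d, eventually_δ₀_pos] with n h1 h2
  linarith

/-- `δ'(n) → 0`. [folklore] -/
theorem tendsto_δseqF (d : ℕ) : Tendsto (δseqF d) atTop (𝓝 0) := by
  have hc : Tendsto (cQF d 2) atTop (𝓝 0) :=
    (isLittleO_cQF d 2).trans_tendsto (by simpa using tendsto_δ₀.pow 2)
  have h1 : Tendsto (fun n ↦ (yseq n + y1 n) / 2 - cQF d 2 n) atTop (𝓝 0) := by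
    simpa using ((tendsto_yseq.add tendsto_y1).div_const 2).sub hc
  have h2 := h1.sqrt
  rw [Real.sqrt_zero] at h2
  exact h2

/-- `δ₀(n)^i = O(δ'(n)^i)`. [folklore] -/
theorem isBigO_δ₀_pow_δseqF_pow (d i : ℕ) :
    (fun n ↦ δ₀ n ^ i) =O[atTop] fun n ↦ δseqF d n ^ i := by
  refine IsBigO.of_bound (2 ^ i) ?_
  filter_upwards [eventually_δ₀_le_two_mul_δseqF d, eventually_δseqF_pos d] with n h1 h2
  rw [Real.norm_eq_abs, Real.norm_eq_abs, abs_of_nonneg (pow_nonneg (δ₀_nonneg n) i),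
    abs_of_nonneg (pow_nonneg h2.le i), ← mul_pow]
  exact pow_le_pow_left₀ (δ₀_nonneg n) h1 i

/-- **The GORZ-type expansion (15) for `a_n = γ(n)/n!`, degrees `d ≥ 2`.** [folklore] -/
theorem xiTaylorCoeff_div_factorial_logRatio_of_two_le {d : ℕ} (hd : 2 ≤ d) :
    ∃ (A δ : ℕ → ℝ) (g : ℕ → ℕ → ℝ),
    (∀ᶠ n in atTop, 0 < δ n) ∧ Tendsto δ atTop (𝓝 0) ∧
    (∀ i, 3 ≤ i → i ≤ d → (g i) =o[atTop] fun n ↦ δ n ^ i) ∧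
    ∀ j : ℕ, j ≤ d → (fun n ↦
        Real.log ((xiTaylorCoeff (n + j) / ((n + j)! : ℝ)) / (xiTaylorCoeff n / (n ! : ℝ))) -
        (A n * j - δ n ^ 2 * (j : ℝ) ^ 2 + ∑ i ∈ Icc 3 d, g i n * (j : ℝ) ^ i)) =o[atTop]
        fun n ↦ δ n ^ d := by
  refine ⟨AseqF d, δseqF d, gseqF d, eventually_δseqF_pos d, tendsto_δseqF d, fun i _ _ ↦
    (isLittleO_cQF d i).trans_isBigO (isBigO_δ₀_pow_δseqF_pow d i), fun j hj ↦ ?_⟩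
  have hd1 : 1 ≤ d := by omega
  have hmain := logRatioF_sub_isLittleO hd1 hj
  have htail := (isNegl_QpolyF d).isLittleO_eval_sub_sum (j : ℝ) d
  have hev : ∀ᶠ n in atTop,
      (Real.log ((xiTaylorCoeff (n + j) / ((n + j)! : ℝ)) / (xiTaylorCoeff n / (n ! : ℝ))) -
        (AseqF0 n * j - (yseq n + y1 n) / 2 * (j : ℝ) ^ 2 + (QpolyF d n).eval (j : ℝ))) +
      ((QpolyF d n).eval (j : ℝ) - ∑ i ∈ Icc 1 d, (QpolyF d n).coeff i * (j : ℝ) ^ i) =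
      Real.log ((xiTaylorCoeff (n + j) / ((n + j)! : ℝ)) / (xiTaylorCoeff n / (n ! : ℝ))) -
      (AseqF d n * j - δseqF d n ^ 2 * (j : ℝ) ^ 2 + ∑ i ∈ Icc 3 d, gseqF d i n * (j : ℝ) ^ i) := by
    filter_upwards [eventually_δseqF_sq d] with n hn
    have hsplit : ∑ i ∈ Icc 1 d, (QpolyF d n).coeff i * (j : ℝ) ^ i =
        cQF d 1 n * j + cQF d 2 n * (j : ℝ) ^ 2 + ∑ i ∈ Icc 3 d, gseqF d i n * (j : ℝ) ^ i := by
      rw [← Finset.insert_Icc_add_one_left_eq_Icc (by omega : 1 ≤ d), sum_insert (by simp),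
        show (1 : ℕ) + 1 = 2 from rfl,
        ← Finset.insert_Icc_add_one_left_eq_Icc (by omega : 2 ≤ d), sum_insert (by simp)]
      simp only [cQF, gseqF, pow_one]
      ring
    rw [hsplit, hn, AseqF]
    ring
  exact ((hmain.add htail).congr' hev (Eventually.of_forall fun _ ↦ rfl)).trans_isBigO
    (isBigO_δ₀_pow_δseqF_pow d d)

/-- **The GORZ-type expansion (GORZ 2019, §5.1 eq. (15) shape) for `a_n = γ(n)/n!`**, all
degrees `d ≥ 1`: there are `A(n)`, `δ(n) → 0⁺`, `gᵢ(n) = o(δ(n)ⁱ)` (`3 ≤ i ≤ d`) with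
`log(a(n+j)/a(n)) = A(n) j - δ(n)² j² + ∑_{i=3}^{d} gᵢ(n) jⁱ + o(δ(n)^d)` for `0 ≤ j ≤ d`
(`δ(n)² ∼ 1/n`: the factorial doubles the Gaussian width parameter of (15) for `γ`).
[folklore] -/
theorem xiTaylorCoeff_div_factorial_logRatio : ∀ d : ℕ, 1 ≤ d →
    ∃ (A δ : ℕ → ℝ) (g : ℕ → ℕ → ℝ),
    (∀ᶠ n in atTop, 0 < δ n) ∧ Tendsto δ atTop (𝓝 0) ∧
    (∀ i, 3 ≤ i → i ≤ d → (g i) =o[atTop] fun n ↦ δ n ^ i) ∧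
    ∀ j : ℕ, j ≤ d → (fun n ↦
        Real.log ((xiTaylorCoeff (n + j) / ((n + j)! : ℝ)) / (xiTaylorCoeff n / (n ! : ℝ))) -
        (A n * j - δ n ^ 2 * (j : ℝ) ^ 2 + ∑ i ∈ Icc 3 d, g i n * (j : ℝ) ^ i)) =o[atTop]
        fun n ↦ δ n ^ d := by
  intro d hd
  rcases le_or_gt 2 d with hd2 | hd2
  · exact xiTaylorCoeff_div_factorial_logRatio_of_two_le hd2
  · obtain rfl : d = 1 := by omega
    obtain ⟨A, δ, g, h1, h2, h3, h4⟩ := xiTaylorCoeff_div_factorial_logRatio_of_two_le (le_refl 2)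
    refine ⟨A, δ, g, h1, h2, fun i hi hi' ↦ by omega, fun j hj ↦ ?_⟩
    have h := h4 j (by omega)
    have hI : Icc 3 2 = (∅ : Finset ℕ) := by decide
    have hI' : Icc 3 1 = (∅ : Finset ℕ) := by decide
    simp only [hI, sum_empty] at h
    simp only [hI', sum_empty]
    refine h.trans_isBigO (IsBigO.of_bound' ?_)
    have hsmall : ∀ᶠ n in atTop, |δ n| ≤ 1 := by
      have := Metric.tendsto_nhds.1 h2 1 one_pos
      exact this.mono fun n hn ↦ by rw [Real.dist_0_eq_abs] at hn; exact hn.le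
    filter_upwards [hsmall] with n hn
    rw [Real.norm_eq_abs, Real.norm_eq_abs, abs_pow, abs_pow, pow_one]
    exact pow_le_of_le_one (abs_nonneg _) hn two_ne_zero

end GORZAsymp

end Literature.NumberTheory.LFunctions
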